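import Summits.QuantumFields.YangMills.Theorems.BalabanUVNodesN21ReadSetDisj
import Summits.QuantumFields.YangMills.Theorems.BalabanUVNodesN21ThresholdMixtureRStepMarginals

/-!
# N21 (NE7c), strategy s3 «alternative currency», file 32 — THE MIXTURE ROAD's ℝ-STEP IDENTITIES AT def-R's NORMALISED FAMILY `𝔟ᴺ` WITH (LOC) AND
# (DISJ) AS THEOREMS: file 21's (0.4)-per-summand and file 23's (N)∕(Eoff) marginal identity, instantiated at the tested statistics `u_□ = statᴺ_□` of
# (2.17), hold for every family of cubes whose `□^{≈7}` misses `Z` and every fibre `⊆ bondsMeeting k Z` — binders left: (H-U) measurability of the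
# (2.16) background on `□^{≈4}`, the telescope's provisos, and numerics

HEADER — WORK-UNIT METADATA.  Seat `pub-ymgap-dag-n21-e` (R141 (C) fan-out, node N21 = NE7c, strategy s3), g10, file 32 (g9 HANDOFF trigger t31 «a consumer's
one-application corollary at `𝔟ᴺ`», taken by own hand now that (DISJ) is discharged); sequel of files 31 (`…N21ReadSetDisj`: `fibreIndep_recordStatN_of_far`),
21 (`…ThresholdMixtureRStepCommonBox`, p514528: `integral_rstepSummand_eq`, `rstepWeight_eq`) and 23 (`…ThresholdMixtureRStepMarginals`, p521091:
`map_withDensity_rstepSummand_eq_of_le`).  Lane: `--kind proof --supports stmt-QuantumFields-20509 --as helper` (K3⁶ `SpineGivenEndpointR13SepCoPR`).  Count-neutral.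

THE CONTENT.  Files 20–23 type print's ℝ ((0.3)–(0.4) of [Balaban1989LargeFieldI] p. 176) on the mixture road at GENERIC letters: per old summand, per threshold
vector, the post-ℝ weight equals the pre-ℝ weight and every fibre-independent statistic keeps its marginal — under two displayed inputs on the tested variables
`u_□` of the sharp χ-slots: `huI` (KT-28, fibre-independence OFF the fibre) and `hum` (measurability).  Files 22c ∕ 28 ∕ 29 ∕ 30 ∕ 31 turned `huI` at def-R's
normalised family `𝔟ᴺ K k := normalise (bgFamOfRecord F N ν K k) _` into a theorem of the GEOMETRY: cube `□` qualifies as soon as `□^{≈7} ∩ Z = ∅` for a fibre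
`⊆ bondsMeeting k Z` (31 `fibreIndep_recordStatN_of_far`).  This file is the junction, BY NAME:
§1 `measurable_recordStatN` — (H-U) by value at `𝔟ᴺ`: if `V ↦ U_{k,□}(V)` (`ukBox (𝔟ᴺ K k) M₁ □^{≈4} k`) is measurable then so is `statᴺ_□` (13a `measurable_iSup_dist1`).
§2 ★ `integral_rstepSummand_eq_bgN` — file 21's (0.4) per summand at `u := statᴺ`: for cube families `A″ ⊆ A` with every `□ ∈ A` far from `Z`, agreeing
   polarities on `A″`, provisos on the factor-free parts: `∫ normTerm(fib)(c″f″)(c f) dV = ∫ c f dV`, `c = ∏_{A} (pol □).fac 1[statᴺ_□ < S_□]`, `c″ = ∏_{A″} …`;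
   ★ `rstepWeight_eq_bgN` — the same at every threshold vector for `S`-dependent slots (file 21 `rstepWeight_eq`).
§3 ★★ `map_rstepSummand_eq_bgN` — file 23's (N)∕(Eoff): for every measurable fibre-independent statistic `w`, `(dV·normTerm(fib)(c″f″)(c f)).map w =
   (dV·(c f)).map w` — 20n's `hoff`∕`hN` shape at the current field, AT `𝔟ᴺ`, with (LOC)+(DISJ) no longer hypotheses; ★★ `map_rstepSummand_eq_bgN_fibOfSeq` —
   the one application at def-R's fibre `fibOfSeq F ν τ p g k sq` ∕ `Z′(sq) = zpOfSeq …`.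

HONEST FRAMING.  NE7c is NOT PRINTED and NOT PROVED.  [folklore] bookkeeping: three applications of landed theorems with 31's geometric `huI`.  Binders left and
DISPLAYED: (H-U) `Measurable (ukBox (𝔟ᴺ K k) M₁ □^{≈4} k)` per cube of `A` (def-R g18: `𝔟ᴺ` has no measurability proof; K0c's §F selector is the cure), the
telescope provisos `TermProvisos fib f″ f C`, the numerics `0 < k ≤ m + K`, `1 ≤ M₁`, `1 ≤ M₂`, `L·M₁ ≤ L^{k+1}M₂R_k`, and the geometry `□^{≈7} ∩ Z = ∅` on `A`
(which cubes are OFF); the identification of `𝔟ᴺ`'s χ with the record's RAW χ stays one-sided (28 (N4), `huniq`).  Nothing of Bałaban's asserted; N21 NOT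
discharged; counts UNMOVED; count-neutral; one finite 𝕋⁴ at fixed `ε`; NOT ℝ⁴ ∕ OS ∕ mass gap ∕ Clay.

CITATION HEADER (lean-in-tree rule 2026-08-18).  BY NAME: 31 `fibreIndep_recordStatN_of_far` ∕ `mem_bondsMeeting_of_mem_fibOfSeq`; 21 `integral_rstepSummand_eq` ∕
`rstepWeight_eq` ∕ `fibreIndep_prod_fac_smallInd` ∕ `prod_fac_smallInd_le_of_subset` ∕ `measurable_prod_fac_smallInd_field`; 13 `prod_fac_smallInd_mem_unitInterval`;
23 `map_withDensity_rstepSummand_eq_of_le`; 13a `measurable_iSup_dist1`; b01 `B15.BasicStep.normTerm`; `T4ObservableTelescope.TermProvisos`; `T4DressedR.FibreIndep`;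
`T4IndicatorShell.smallInd`; `T4LipschitzLedger.Pol`; `Setup.fieldMeasure`; def-R `Node00.bgFamOfRecord` ∕ `cubeEnl` ∕ `cubeSide` ∕ `cubeIndices` ∕ `RkOfRecord` ∕
`bondsMeeting` ∕ `fibOfSeq` ∕ `zpOfSeq`; r11 `B14.Eq12InteriorLocality.normalise` ∕ `plaqDetermined_plaqSmall` ∕ `B14.Eq216Concrete.ukBox`.  Context only (SHAPE,
nothing asserted): [Balaban1989LargeFieldI] (0.3)–(0.4) p. 176; [Balaban1988Convergent] (2.16)–(2.18) p. 257.
-/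

set_option autoImplicit false

noncomputable section

open MeasureTheory Set
open scoped BigOperators ENNReal

namespace Summit.QuantumFields.YangMills.Theorems.N21RStepMarginalsBgN

open Literature.MathematicalPhysics.QuantumFieldTheory.Balaban1983to89
open Literature.MathematicalPhysics.QuantumFieldTheory.Balaban1983to89.Node00
open T4Continuum B15DeterminingSets B14.Eq213DetSet B14.Eq216Concrete B14.Eq12InteriorLocality B14.Eq213MaximalDomains B15Eq112TorusCover
  B14DomainGeom B14.Eq218Concrete
open Literature.MathematicalPhysics.QuantumFieldTheory.Balaban1983to89.B15.BasicStep (normTerm)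
open Literature.MathematicalPhysics.QuantumFieldTheory.Balaban1983to89.T4DressedR (FibreIndep)
open Literature.MathematicalPhysics.QuantumFieldTheory.Balaban1983to89.T4ObservableTelescope (TermProvisos)
open Literature.MathematicalPhysics.QuantumFieldTheory.Balaban1983to89.T4IndicatorShell (smallInd)
open Literature.MathematicalPhysics.QuantumFieldTheory.Balaban1983to89.T4LipschitzLedger (Pol)
open Summit.QuantumFields.YangMills.Theorems.N21ThresholdMixtureRecordChi (measurable_iSup_dist1)
open Summit.QuantumFields.YangMills.Theorems.N21ThresholdMixtureTStepChi (prod_fac_smallInd_mem_unitInterval)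
open Summit.QuantumFields.YangMills.Theorems.N21ThresholdMixtureRStepCommonBox (fibreIndep_prod_fac_smallInd prod_fac_smallInd_le_of_subset
  measurable_prod_fac_smallInd_field integral_rstepSummand_eq rstepWeight_eq)
open Summit.QuantumFields.YangMills.Theorems.N21ThresholdMixtureRStepMarginals (map_withDensity_rstepSummand_eq_of_le)
open Summit.QuantumFields.YangMills.Theorems.N21ReadSetDisj (fibreIndep_recordStatN_of_far mem_bondsMeeting_of_mem_fibOfSeq)

variable (F : T4Family) (N : ℕ) [NeZero N]

/-! ## §1 (H-U) by value at `𝔟ᴺ`: measurability of the tested statistic -/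

/-- (H-U) BY VALUE AT `𝔟ᴺ`: if the (2.16) background `V ↦ U_{k,□}(V)` over the normalised datum family is a measurable map of the field, the tested statistic
`statᴺ_□(V) = sup_{p ⊂ □^∼} |U_{k,□}(V)(∂p) − 1|` is measurable (13a `measurable_iSup_dist1`). [cite: Balaban1988Convergent, (2.16)–(2.17) p.257 (bookkeeping)] -/
theorem measurable_recordStatN (ν : Stage7Numerics) (g : ℕ → ℝ) (K k : ℕ) (a : Pt (F.P K).d)
    (hU : Measurable (ukBox (normalise (bgFamOfRecord F N ν K k) (plaqDetermined_plaqSmall _)) ν.M₁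
      (cubeEnl (F.P K) (cubeSide (F.P K).L ν.M₂ (RkOfRecord (F.P K).L ν.r (g k)) k) a 4) k)) :
    Measurable fun V : GaugeField (F.P K) k (SU N) =>
      ⨆ p : ↥(plaqInside (cubeEnl (F.P K) (cubeSide (F.P K).L ν.M₂ (RkOfRecord (F.P K).L ν.r (g k)) k) a 1)),
        dist1 (GaugeField.plaqHol (ukBox (normalise (bgFamOfRecord F N ν K k) (plaqDetermined_plaqSmall _)) ν.M₁
          (cubeEnl (F.P K) (cubeSide (F.P K).L ν.M₂ (RkOfRecord (F.P K).L ν.r (g k)) k) a 4) k V) p.1) :=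
  (measurable_iSup_dist1 _).comp hU

/-! ## §2 File 21's (0.4) per summand ∕ per threshold vector at `u := statᴺ` -/

/-- ★ **(0.4) PER SUMMAND AT `𝔟ᴺ`, (LOC)+(DISJ) AS THEOREMS** (21 `integral_rstepSummand_eq` at `u := statᴺ`): for a fibre `fib ⊆ bondsMeeting k Z`, cube families
`A″ ⊆ A` with EVERY `□ ∈ A` FAR FROM `Z` (`□^{≈7} ∩ Z = ∅`), polarities agreeing on `A″`, (H-U) by value on `A`, and provisos on the factor-free parts, the post-ℝ
summand has the sender's sharp mass at every threshold vector `S`.  Binders: `0 < k ≤ m + K`, `1 ≤ M₁`, `1 ≤ M₂`, `L·M₁ ≤ L^{k+1}M₂R_k`.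
[cite: Balaban1989LargeFieldI, (0.4) p.176; Balaban1988Convergent, (2.16)–(2.18) p.257] -/
theorem integral_rstepSummand_eq_bgN (ν : Stage7Numerics) (g : ℕ → ℝ) (K k : ℕ) [DecidableEq (PBond (F.P K) k)]
    (hk : k ≤ (F.P K).m + (F.P K).K) (hk0 : 0 < k) (hM : 1 ≤ ν.M₁) (hM₂ : 1 ≤ ν.M₂)
    (hnum : (F.P K).L * ν.M₁ ≤ cubeSide (F.P K).L ν.M₂ (RkOfRecord (F.P K).L ν.r (g k)) k)
    (Z : Set (Site (F.P K) 0)) (fib : Finset (PBond (F.P K) k)) (hfib : ∀ b ∈ fib, b ∈ bondsMeeting k Z)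
    {A A'' : Finset ↥(cubeIndices (F.P K) (cubeSide (F.P K).L ν.M₂ (RkOfRecord (F.P K).L ν.r (g k)) k))} (hsub : A'' ⊆ A)
    (hA : ∀ c ∈ A, ∀ z ∈ Z, z ∉ cubeEnl (F.P K) (cubeSide (F.P K).L ν.M₂ (RkOfRecord (F.P K).L ν.r (g k)) k) c 7)
    (pol pol'' : ↥(cubeIndices (F.P K) (cubeSide (F.P K).L ν.M₂ (RkOfRecord (F.P K).L ν.r (g k)) k)) → Pol) (hpol : ∀ c ∈ A'', pol'' c = pol c)
    (hU : ∀ c ∈ A, Measurable (ukBox (normalise (bgFamOfRecord F N ν K k) (plaqDetermined_plaqSmall _)) ν.M₁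
      (cubeEnl (F.P K) (cubeSide (F.P K).L ν.M₂ (RkOfRecord (F.P K).L ν.r (g k)) k) c 4) k))
    {f f'' : Density (F.P K) k (SU N)} {C : ℝ} (hP : TermProvisos fib f'' f C)
    (S : ↥(cubeIndices (F.P K) (cubeSide (F.P K).L ν.M₂ (RkOfRecord (F.P K).L ν.r (g k)) k)) → ℝ) :
    ∫ V, normTerm fib
        (fun U => (∏ c ∈ A'', (pol'' c).fac (smallInd
          (⨆ p : ↥(plaqInside (cubeEnl (F.P K) (cubeSide (F.P K).L ν.M₂ (RkOfRecord (F.P K).L ν.r (g k)) k) c 1)),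
            dist1 (GaugeField.plaqHol (ukBox (normalise (bgFamOfRecord F N ν K k) (plaqDetermined_plaqSmall _)) ν.M₁
              (cubeEnl (F.P K) (cubeSide (F.P K).L ν.M₂ (RkOfRecord (F.P K).L ν.r (g k)) k) c 4) k U) p.1)) (S c))) * f'' U)
        (fun U => (∏ c ∈ A, (pol c).fac (smallInd
          (⨆ p : ↥(plaqInside (cubeEnl (F.P K) (cubeSide (F.P K).L ν.M₂ (RkOfRecord (F.P K).L ν.r (g k)) k) c 1)),
            dist1 (GaugeField.plaqHol (ukBox (normalise (bgFamOfRecord F N ν K k) (plaqDetermined_plaqSmall _)) ν.M₁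
              (cubeEnl (F.P K) (cubeSide (F.P K).L ν.M₂ (RkOfRecord (F.P K).L ν.r (g k)) k) c 4) k U) p.1)) (S c))) * f U) V
        ∂fieldMeasure (F.P K) k (SU N)
      = ∫ V, (∏ c ∈ A, (pol c).fac (smallInd
          (⨆ p : ↥(plaqInside (cubeEnl (F.P K) (cubeSide (F.P K).L ν.M₂ (RkOfRecord (F.P K).L ν.r (g k)) k) c 1)),
            dist1 (GaugeField.plaqHol (ukBox (normalise (bgFamOfRecord F N ν K k) (plaqDetermined_plaqSmall _)) ν.M₁
              (cubeEnl (F.P K) (cubeSide (F.P K).L ν.M₂ (RkOfRecord (F.P K).L ν.r (g k)) k) c 4) k V) p.1)) (S c))) * f V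
        ∂fieldMeasure (F.P K) k (SU N) :=
  integral_rstepSummand_eq fib hsub pol pol'' hpol
    (u := fun c V => ⨆ p : ↥(plaqInside (cubeEnl (F.P K) (cubeSide (F.P K).L ν.M₂ (RkOfRecord (F.P K).L ν.r (g k)) k) c 1)),
      dist1 (GaugeField.plaqHol (ukBox (normalise (bgFamOfRecord F N ν K k) (plaqDetermined_plaqSmall _)) ν.M₁
        (cubeEnl (F.P K) (cubeSide (F.P K).L ν.M₂ (RkOfRecord (F.P K).L ν.r (g k)) k) c 4) k V) p.1))
    (fun c hc => fibreIndep_recordStatN_of_far F N ν g K k hk hk0 hM hM₂ hnum c Z fib hfib (hA c hc))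
    (fun c hc => measurable_recordStatN F N ν g K k c.1 (hU c hc)) hP S

/-- ★ **POST-ℝ WEIGHT = PRE-ℝ WEIGHT AT EVERY THRESHOLD VECTOR, AT `𝔟ᴺ`** (21 `rstepWeight_eq` at `u := statᴺ`), for slots that may themselves depend on the threshold
vector, with threshold-free provisos at each `S`; same far-cube geometry and (H-U) by value. [cite: Balaban1989LargeFieldI, (0.4) p.176; Balaban1988Convergent, (2.17)–(2.18) p.257] -/
theorem rstepWeight_eq_bgN {Θ : Type*} (ν : Stage7Numerics) (g : ℕ → ℝ) (K k : ℕ) [DecidableEq (PBond (F.P K) k)]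
    (hk : k ≤ (F.P K).m + (F.P K).K) (hk0 : 0 < k) (hM : 1 ≤ ν.M₁) (hM₂ : 1 ≤ ν.M₂)
    (hnum : (F.P K).L * ν.M₁ ≤ cubeSide (F.P K).L ν.M₂ (RkOfRecord (F.P K).L ν.r (g k)) k)
    (Z : Set (Site (F.P K) 0)) (fib : Finset (PBond (F.P K) k)) (hfib : ∀ b ∈ fib, b ∈ bondsMeeting k Z)
    {A A'' : Finset ↥(cubeIndices (F.P K) (cubeSide (F.P K).L ν.M₂ (RkOfRecord (F.P K).L ν.r (g k)) k))} (hsub : A'' ⊆ A)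
    (hA : ∀ c ∈ A, ∀ z ∈ Z, z ∉ cubeEnl (F.P K) (cubeSide (F.P K).L ν.M₂ (RkOfRecord (F.P K).L ν.r (g k)) k) c 7)
    (pol pol'' : ↥(cubeIndices (F.P K) (cubeSide (F.P K).L ν.M₂ (RkOfRecord (F.P K).L ν.r (g k)) k)) → Pol) (hpol : ∀ c ∈ A'', pol'' c = pol c)
    (hU : ∀ c ∈ A, Measurable (ukBox (normalise (bgFamOfRecord F N ν K k) (plaqDetermined_plaqSmall _)) ν.M₁
      (cubeEnl (F.P K) (cubeSide (F.P K).L ν.M₂ (RkOfRecord (F.P K).L ν.r (g k)) k) c 4) k))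
    (fS f''S : Θ → Density (F.P K) k (SU N)) {C : ℝ} (hP : ∀ S, TermProvisos fib (f''S S) (fS S) C)
    (thr : Θ → ↥(cubeIndices (F.P K) (cubeSide (F.P K).L ν.M₂ (RkOfRecord (F.P K).L ν.r (g k)) k)) → ℝ) (S : Θ) :
    ∫ V, normTerm fib
        (fun U => (∏ c ∈ A'', (pol'' c).fac (smallInd
          (⨆ p : ↥(plaqInside (cubeEnl (F.P K) (cubeSide (F.P K).L ν.M₂ (RkOfRecord (F.P K).L ν.r (g k)) k) c 1)),
            dist1 (GaugeField.plaqHol (ukBox (normalise (bgFamOfRecord F N ν K k) (plaqDetermined_plaqSmall _)) ν.M₁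
              (cubeEnl (F.P K) (cubeSide (F.P K).L ν.M₂ (RkOfRecord (F.P K).L ν.r (g k)) k) c 4) k U) p.1)) (thr S c))) * f''S S U)
        (fun U => (∏ c ∈ A, (pol c).fac (smallInd
          (⨆ p : ↥(plaqInside (cubeEnl (F.P K) (cubeSide (F.P K).L ν.M₂ (RkOfRecord (F.P K).L ν.r (g k)) k) c 1)),
            dist1 (GaugeField.plaqHol (ukBox (normalise (bgFamOfRecord F N ν K k) (plaqDetermined_plaqSmall _)) ν.M₁
              (cubeEnl (F.P K) (cubeSide (F.P K).L ν.M₂ (RkOfRecord (F.P K).L ν.r (g k)) k) c 4) k U) p.1)) (thr S c))) * fS S U) V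
        ∂fieldMeasure (F.P K) k (SU N)
      = ∫ V, (∏ c ∈ A, (pol c).fac (smallInd
          (⨆ p : ↥(plaqInside (cubeEnl (F.P K) (cubeSide (F.P K).L ν.M₂ (RkOfRecord (F.P K).L ν.r (g k)) k) c 1)),
            dist1 (GaugeField.plaqHol (ukBox (normalise (bgFamOfRecord F N ν K k) (plaqDetermined_plaqSmall _)) ν.M₁
              (cubeEnl (F.P K) (cubeSide (F.P K).L ν.M₂ (RkOfRecord (F.P K).L ν.r (g k)) k) c 4) k V) p.1)) (thr S c))) * fS S V
        ∂fieldMeasure (F.P K) k (SU N) :=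
  rstepWeight_eq fib hsub pol pol'' hpol
    (u := fun c V => ⨆ p : ↥(plaqInside (cubeEnl (F.P K) (cubeSide (F.P K).L ν.M₂ (RkOfRecord (F.P K).L ν.r (g k)) k) c 1)),
      dist1 (GaugeField.plaqHol (ukBox (normalise (bgFamOfRecord F N ν K k) (plaqDetermined_plaqSmall _)) ν.M₁
        (cubeEnl (F.P K) (cubeSide (F.P K).L ν.M₂ (RkOfRecord (F.P K).L ν.r (g k)) k) c 4) k V) p.1))
    (fun c hc => fibreIndep_recordStatN_of_far F N ν g K k hk hk0 hM hM₂ hnum c Z fib hfib (hA c hc))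
    (fun c hc => measurable_recordStatN F N ν g K k c.1 (hU c hc)) fS f''S hP thr S

/-! ## §3 File 23's (N)∕(Eoff) marginal identity at `u := statᴺ` -/

/-- ★★ **THE (N)∕(Eoff) BINDER OF THE RESAMPLING TOWER AT THE CURRENT FIELD, AT `𝔟ᴺ`, (LOC)+(DISJ) AS THEOREMS** (23 `map_withDensity_rstepSummand_eq_of_le`
at `c := ∏_{A} …`, `c″ := ∏_{A″} …`, `u := statᴺ`): for a fibre `fib ⊆ bondsMeeting k Z`, cube families `A″ ⊆ A` far from `Z`, agreeing polarities on `A″`, (H-U) by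
value on `A`, provisos, and every measurable fibre-independent statistic `w`, the `w`-marginal of the post-ℝ summand's law equals the `w`-marginal of the sender's law.
Binders: `0 < k ≤ m + K`, `1 ≤ M₁`, `1 ≤ M₂`, `L·M₁ ≤ L^{k+1}M₂R_k`. [cite: Balaban1989LargeFieldI, (0.3)–(0.4) p.176; Balaban1988Convergent, (2.16)–(2.18) p.257] -/
theorem map_rstepSummand_eq_bgN (ν : Stage7Numerics) (g : ℕ → ℝ) (K k : ℕ) [DecidableEq (PBond (F.P K) k)]
    (hk : k ≤ (F.P K).m + (F.P K).K) (hk0 : 0 < k) (hM : 1 ≤ ν.M₁) (hM₂ : 1 ≤ ν.M₂)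
    (hnum : (F.P K).L * ν.M₁ ≤ cubeSide (F.P K).L ν.M₂ (RkOfRecord (F.P K).L ν.r (g k)) k)
    (Z : Set (Site (F.P K) 0)) (fib : Finset (PBond (F.P K) k)) (hfib : ∀ b ∈ fib, b ∈ bondsMeeting k Z)
    {A A'' : Finset ↥(cubeIndices (F.P K) (cubeSide (F.P K).L ν.M₂ (RkOfRecord (F.P K).L ν.r (g k)) k))} (hsub : A'' ⊆ A)
    (hA : ∀ c ∈ A, ∀ z ∈ Z, z ∉ cubeEnl (F.P K) (cubeSide (F.P K).L ν.M₂ (RkOfRecord (F.P K).L ν.r (g k)) k) c 7)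
    (pol pol'' : ↥(cubeIndices (F.P K) (cubeSide (F.P K).L ν.M₂ (RkOfRecord (F.P K).L ν.r (g k)) k)) → Pol) (hpol : ∀ c ∈ A'', pol'' c = pol c)
    (hU : ∀ c ∈ A, Measurable (ukBox (normalise (bgFamOfRecord F N ν K k) (plaqDetermined_plaqSmall _)) ν.M₁
      (cubeEnl (F.P K) (cubeSide (F.P K).L ν.M₂ (RkOfRecord (F.P K).L ν.r (g k)) k) c 4) k))
    {f f'' : Density (F.P K) k (SU N)} {C : ℝ} (hP : TermProvisos fib f'' f C)
    (S : ↥(cubeIndices (F.P K) (cubeSide (F.P K).L ν.M₂ (RkOfRecord (F.P K).L ν.r (g k)) k)) → ℝ)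
    {w : GaugeField (F.P K) k (SU N) → ℝ} (hwm : Measurable w) (hw : FibreIndep fib w) :
    ((fieldMeasure (F.P K) k (SU N)).withDensity fun V => ENNReal.ofReal (normTerm fib
        (fun U => (∏ c ∈ A'', (pol'' c).fac (smallInd
          (⨆ p : ↥(plaqInside (cubeEnl (F.P K) (cubeSide (F.P K).L ν.M₂ (RkOfRecord (F.P K).L ν.r (g k)) k) c 1)),
            dist1 (GaugeField.plaqHol (ukBox (normalise (bgFamOfRecord F N ν K k) (plaqDetermined_plaqSmall _)) ν.M₁
              (cubeEnl (F.P K) (cubeSide (F.P K).L ν.M₂ (RkOfRecord (F.P K).L ν.r (g k)) k) c 4) k U) p.1)) (S c))) * f'' U)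
        (fun U => (∏ c ∈ A, (pol c).fac (smallInd
          (⨆ p : ↥(plaqInside (cubeEnl (F.P K) (cubeSide (F.P K).L ν.M₂ (RkOfRecord (F.P K).L ν.r (g k)) k) c 1)),
            dist1 (GaugeField.plaqHol (ukBox (normalise (bgFamOfRecord F N ν K k) (plaqDetermined_plaqSmall _)) ν.M₁
              (cubeEnl (F.P K) (cubeSide (F.P K).L ν.M₂ (RkOfRecord (F.P K).L ν.r (g k)) k) c 4) k U) p.1)) (S c))) * f U) V)).map w
      = ((fieldMeasure (F.P K) k (SU N)).withDensity fun V => ENNReal.ofReal ((∏ c ∈ A, (pol c).fac (smallInd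
          (⨆ p : ↥(plaqInside (cubeEnl (F.P K) (cubeSide (F.P K).L ν.M₂ (RkOfRecord (F.P K).L ν.r (g k)) k) c 1)),
            dist1 (GaugeField.plaqHol (ukBox (normalise (bgFamOfRecord F N ν K k) (plaqDetermined_plaqSmall _)) ν.M₁
              (cubeEnl (F.P K) (cubeSide (F.P K).L ν.M₂ (RkOfRecord (F.P K).L ν.r (g k)) k) c 4) k V) p.1)) (S c))) * f V)).map w := by
  -- the tested statistics at `𝔟ᴺ`, their fibre-independence (31) and measurability ((H-U) by value)
  set u : ↥(cubeIndices (F.P K) (cubeSide (F.P K).L ν.M₂ (RkOfRecord (F.P K).L ν.r (g k)) k)) → Density (F.P K) k (SU N) :=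
    fun c V => ⨆ p : ↥(plaqInside (cubeEnl (F.P K) (cubeSide (F.P K).L ν.M₂ (RkOfRecord (F.P K).L ν.r (g k)) k) c 1)),
      dist1 (GaugeField.plaqHol (ukBox (normalise (bgFamOfRecord F N ν K k) (plaqDetermined_plaqSmall _)) ν.M₁
        (cubeEnl (F.P K) (cubeSide (F.P K).L ν.M₂ (RkOfRecord (F.P K).L ν.r (g k)) k) c 4) k V) p.1) with hu
  have huI : ∀ c ∈ A, FibreIndep fib (u c) := fun c hc =>
    fibreIndep_recordStatN_of_far F N ν g K k hk hk0 hM hM₂ hnum c Z fib hfib (hA c hc)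
  have hum : ∀ c ∈ A, Measurable (u c) := fun c hc => measurable_recordStatN F N ν g K k c.1 (hU c hc)
  exact map_withDensity_rstepSummand_eq_of_le fib hP
    (measurable_prod_fac_smallInd_field A pol hum S)
    (measurable_prod_fac_smallInd_field A'' pol'' (fun c hc => hum c (hsub hc)) S)
    (fibreIndep_prod_fac_smallInd fib A pol huI S) (fibreIndep_prod_fac_smallInd fib A'' pol'' (fun c hc => huI c (hsub hc)) S)
    (fun V => (prod_fac_smallInd_mem_unitInterval A pol (fun c => u c V) S).1)
    (fun V => (prod_fac_smallInd_mem_unitInterval A'' pol'' (fun c => u c V) S).1)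
    (fun V => (prod_fac_smallInd_mem_unitInterval A pol (fun c => u c V) S).2)
    (fun V => prod_fac_smallInd_le_of_subset hsub pol pol'' hpol (fun c => u c V) S) hwm hw

/-- ★★ **ONE APPLICATION AT def-R's FIBRE** (`fib := fibOfSeq F ν τ p g k sq`, `Z := Z′(sq) = zpOfSeq …`): the marginal identity of §3 for the (0.3) fibre of a
large-field sequence `sq`, on cube families far from `Z′(sq)`. [cite: Balaban1989LargeFieldI, (0.3)–(0.4) p.176, (1.1) p.177; Balaban1988Convergent, (2.16)–(2.18) p.257] -/
theorem map_rstepSummand_eq_bgN_fibOfSeq (ν : Stage7Numerics) (τ : TowerNumerics) (p : B12.RunParams) (g : ℕ → ℝ) (k : ℕ)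
    [DecidableEq (PBond (F.P p.K) k)]
    (hk : k ≤ (F.P p.K).m + (F.P p.K).K) (hk0 : 0 < k) (hM : 1 ≤ ν.M₁) (hM₂ : 1 ≤ ν.M₂)
    (hnum : (F.P p.K).L * ν.M₁ ≤ cubeSide (F.P p.K).L ν.M₂ (RkOfRecord (F.P p.K).L ν.r (g k)) k)
    (sq : SeqOfRecord F ν τ.M g p.K k)
    {A A'' : Finset ↥(cubeIndices (F.P p.K) (cubeSide (F.P p.K).L ν.M₂ (RkOfRecord (F.P p.K).L ν.r (g k)) k))} (hsub : A'' ⊆ A)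
    (hA : ∀ c ∈ A, ∀ z ∈ zpOfSeq F ν τ g p.K k sq, z ∉ cubeEnl (F.P p.K) (cubeSide (F.P p.K).L ν.M₂ (RkOfRecord (F.P p.K).L ν.r (g k)) k) c 7)
    (pol pol'' : ↥(cubeIndices (F.P p.K) (cubeSide (F.P p.K).L ν.M₂ (RkOfRecord (F.P p.K).L ν.r (g k)) k)) → Pol) (hpol : ∀ c ∈ A'', pol'' c = pol c)
    (hU : ∀ c ∈ A, Measurable (ukBox (normalise (bgFamOfRecord F N ν p.K k) (plaqDetermined_plaqSmall _)) ν.M₁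
      (cubeEnl (F.P p.K) (cubeSide (F.P p.K).L ν.M₂ (RkOfRecord (F.P p.K).L ν.r (g k)) k) c 4) k))
    {f f'' : Density (F.P p.K) k (SU N)} {C : ℝ} (hP : TermProvisos (fibOfSeq F ν τ p g k sq) f'' f C)
    (S : ↥(cubeIndices (F.P p.K) (cubeSide (F.P p.K).L ν.M₂ (RkOfRecord (F.P p.K).L ν.r (g k)) k)) → ℝ)
    {w : GaugeField (F.P p.K) k (SU N) → ℝ} (hwm : Measurable w) (hw : FibreIndep (fibOfSeq F ν τ p g k sq) w) :
    ((fieldMeasure (F.P p.K) k (SU N)).withDensity fun V => ENNReal.ofReal (normTerm (fibOfSeq F ν τ p g k sq)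
        (fun U => (∏ c ∈ A'', (pol'' c).fac (smallInd
          (⨆ q : ↥(plaqInside (cubeEnl (F.P p.K) (cubeSide (F.P p.K).L ν.M₂ (RkOfRecord (F.P p.K).L ν.r (g k)) k) c 1)),
            dist1 (GaugeField.plaqHol (ukBox (normalise (bgFamOfRecord F N ν p.K k) (plaqDetermined_plaqSmall _)) ν.M₁
              (cubeEnl (F.P p.K) (cubeSide (F.P p.K).L ν.M₂ (RkOfRecord (F.P p.K).L ν.r (g k)) k) c 4) k U) q.1)) (S c))) * f'' U)
        (fun U => (∏ c ∈ A, (pol c).fac (smallInd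
          (⨆ q : ↥(plaqInside (cubeEnl (F.P p.K) (cubeSide (F.P p.K).L ν.M₂ (RkOfRecord (F.P p.K).L ν.r (g k)) k) c 1)),
            dist1 (GaugeField.plaqHol (ukBox (normalise (bgFamOfRecord F N ν p.K k) (plaqDetermined_plaqSmall _)) ν.M₁
              (cubeEnl (F.P p.K) (cubeSide (F.P p.K).L ν.M₂ (RkOfRecord (F.P p.K).L ν.r (g k)) k) c 4) k U) q.1)) (S c))) * f U) V)).map w
      = ((fieldMeasure (F.P p.K) k (SU N)).withDensity fun V => ENNReal.ofReal ((∏ c ∈ A, (pol c).fac (smallInd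
          (⨆ q : ↥(plaqInside (cubeEnl (F.P p.K) (cubeSide (F.P p.K).L ν.M₂ (RkOfRecord (F.P p.K).L ν.r (g k)) k) c 1)),
            dist1 (GaugeField.plaqHol (ukBox (normalise (bgFamOfRecord F N ν p.K k) (plaqDetermined_plaqSmall _)) ν.M₁
              (cubeEnl (F.P p.K) (cubeSide (F.P p.K).L ν.M₂ (RkOfRecord (F.P p.K).L ν.r (g k)) k) c 4) k V) q.1)) (S c))) * f V)).map w :=
  map_rstepSummand_eq_bgN F N ν g p.K k hk hk0 hM hM₂ hnum (zpOfSeq F ν τ g p.K k sq) (fibOfSeq F ν τ p g k sq)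
    (fun _ hb => mem_bondsMeeting_of_mem_fibOfSeq F ν τ p g k sq hb) hsub hA pol pol'' hpol hU hP S hwm hw

end Summit.QuantumFields.YangMills.Theorems.N21RStepMarginalsBgN

end
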